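import Literature.NumberTheory.Transcendental.StandardKernelBaseIso
import Literature.NumberTheory.Transcendental.GammaIsoCrossSaturation
import Literature.NumberTheory.Transcendental.ZilberFieldQuasiminimalProofs
import Literature.NumberTheory.Transcendental.ZilberFieldExistenceProofs
import Literature.ModelTheory.Quasiminimal.PregeometryClasses
import HarnessLib

/-!
# The prime models `ecl(∅)` of two Zilber fields are isomorphic

For Zilber fields `K`, `K'` (models of `ECF_{SK,CCP}`, `IsZilberField`, in one universe) the
exponential-algebraic closures of the empty set are isomorphic exponential fields: there is an
E-ring embedding `ecl^K(∅) → K'` with image `ecl^{K'}(∅)` (`exists_eHom_eclEmpty`). This is the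
hypothesis `h₂` of `ZilberClass.isQuasiminimalPregeometryClass_of` (`ZilberClassAxioms.lean`:
axiom (2) of a quasiminimal pregeometry class, Haykazyan 2016 Def. 2, for the class of Zilber
fields), i.e. the uniqueness of the model of dimension `0` in Kirby's classification of the
countable models (Kirby 2013 (FPEF), Cor. 6.10; Zilber 2005, Lemma 5.11; Bays–Kirby 2018,
Thm 6.9 with Thm 9.1), **proved** here.

## Proof

Let `τ₁`, `τ₂` generate the (standard) kernels. By `GammaField.exists_isEBaseIso₂_of_expKernel`
(`StandardKernelBaseIso.lean`) there is an isomorphism of base Γ-fields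
`σ₀ : ℚ^{ab}(τ₁) = ℚ(τ₁, exp ℚτ₁) ≅ ℚ(τ₂, exp ℚτ₂)` with `σ₀ τ₁ = τ₂`; `ℚτᵢ ◁ Kᵢ` by the Schanuel
property (`schanuelProperty_iff_isStrong_span_kernelGenerator`), and `τᵢ ∈ ecl(∅)`. We run the
two-structure back-and-forth `Literature.ModelTheory.Quasiminimal.exists_map_of_backAndForth₂`
between the countable closures `H₁ = ecl^K(∅)`, `H₂ = ecl^{K'}(∅)` (countable closure property)
through the covering relation `Covered₂`: cross Γ-isomorphisms `c ↦ c'` over `σ₀`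
(`GammaField.IsGammaIsoTw₂`, `GammaIsoCross.lean`) between tuples from `H₁`, `H₂` with
`ℚτ₁ + ℚc ◁ K`, `ℚτ₂ + ℚc' ◁ K'`, started at the empty tuples. Forth (`Covered₂.forth_tau`): a point
`d ∈ H₁` is exponentially algebraic over `ℚτ₁ + ℚc`, hence lies in a finitely generated strong
`E` with `δ(E/ℚτ₁ + ℚc) = 0` (`GammaField.exists_predim_le_zero_of_mem_ecl_coe`, `EclPredim.lean`,
and minimisation of `δ`); the **cross-field `ℵ₀`-saturation over `ℚτ`**
(`ZilberSaturationLog.isGammaIsoTw₂_saturation_tau'`, `GammaIsoCrossSaturation.lean`: Bays–Kirby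
2018 Lemma 8.3 for abstract extensions, from strong exponential-algebraic closedness of `K'`)
realises `E` in `K'` with strong image of predimension `0`, which therefore lies in the Γ-closed
`H₂` (`ZilberHomogeneity.le_of_predim_le_zero_of_isGammaClosed`). Back: the same with `σ₀⁻¹`.
The limit map preserves `0, 1, +, ·, exp` (level-`0` relations of covered tuples) and maps `H₁`
onto `H₂`, whence the E-ring embedding. Everything is proved; no named fact is introduced.

## References

* B. Zilber, *Pseudo-exponentiation on algebraically closed fields of characteristic zero*,
  Ann. Pure Appl. Logic 132 (2005): Lemma 5.11, Thm 5.13.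
* J. Kirby, *Finitely presented exponential fields*, Algebra & Number Theory 7 (2013): Cor. 6.10.
* M. Bays, J. Kirby, *Pseudo-exponential maps, variants, and quasiminimality*, Algebra & Number
  Theory 12 (2018): Def. 5.14, Thm 6.9, Lemma 8.3, Thm 9.1.
* L. Haykazyan, *Categoricity in quasiminimal pregeometry classes*, J. Symbolic Logic 81 (2016):
  Def. 2 (2).
-/

noncomputable section

open Set MvPolynomial

universe u

namespace Literature.NumberTheory.Transcendental

namespace ZilberPrimeModel

open GammaField ZilberHomogeneity ZilberSaturationMain ZilberSaturationLog
  Literature.ModelTheory.ExponentialFields Literature.ModelTheory.ExponentialFields.ExponentialRing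
  Literature.ModelTheory.Quasiminimal

variable {K : Type u} [Field K] [CharZero K] [ExponentialRing K]
variable {K' : Type u} [Field K'] [CharZero K'] [ExponentialRing K']

/-! ### Level-`0` relations of cross Γ-isomorphic tuples -/

section Relations

variable {K₁ : Submodule ℚ K} {K₂ : Submodule ℚ K'} {σ : fieldOf K₁ ≃+* fieldOf K₂} {m : ℕ}
  {c : Fin m → K} {c' : Fin m → K'}

/-- Additive relations among coordinates transfer along a cross Γ-isomorphism. [folklore] -/
theorem add_eq (hiso : IsGammaIsoTw₂ σ c c') {i j k : Fin m} (h : c i + c j = c k) :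
    c' i + c' j = c' k := by
  have := hiso 0 (X (Sum.inl i) + X (Sum.inl j) - X (Sum.inl k))
  simp only [map_add, map_sub, MvPolynomial.map_X, MvPolynomial.aeval_X, lvGens_inl, sub_eq_zero] at this
  exact this.1 h

/-- Multiplicative relations among coordinates transfer along a cross Γ-isomorphism. [folklore] -/
theorem mul_eq (hiso : IsGammaIsoTw₂ σ c c') {i j k : Fin m} (h : c i * c j = c k) :
    c' i * c' j = c' k := by
  have := hiso 0 (X (Sum.inl i) * X (Sum.inl j) - X (Sum.inl k))
  simp only [map_mul, map_sub, MvPolynomial.map_X, MvPolynomial.aeval_X, lvGens_inl, sub_eq_zero] at this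
  exact this.1 h

/-- Exponential relations among coordinates transfer along a cross Γ-isomorphism. [folklore] -/
theorem exp_eq (hiso : IsGammaIsoTw₂ σ c c') {i k : Fin m} (h : exp (c i) = c k) :
    exp (c' i) = c' k := by
  have := hiso 0 (X (Sum.inr i) - X (Sum.inl k))
  simp only [map_sub, MvPolynomial.map_X, MvPolynomial.aeval_X, lvGens_inl, lvGens_zero_inr,
    sub_eq_zero] at this
  exact this.1 h

/-- The coordinate `1` transfers along a cross Γ-isomorphism. [folklore] -/
theorem eq_one (hiso : IsGammaIsoTw₂ σ c c') {i : Fin m} (h : c i = 1) : c' i = 1 := by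
  have := hiso 0 (X (Sum.inl i) - 1)
  simp only [map_sub, map_one, MvPolynomial.map_X, MvPolynomial.aeval_X, lvGens_inl, sub_eq_zero] at this
  exact this.1 h

/-- The coordinate `0` transfers along a cross Γ-isomorphism. [folklore] -/
theorem eq_zero (hiso : IsGammaIsoTw₂ σ c c') {i : Fin m} (h : c i = 0) : c' i = 0 := by
  have := hiso 0 (X (Sum.inl i))
  simp only [MvPolynomial.map_X, MvPolynomial.aeval_X, lvGens_inl] at this
  exact this.1 h

end Relations

/-! ### Cross Γ-isomorphisms of empty tuples -/

/-- Over any `σ`, the empty tuples of two fields are Γ-isomorphic. [folklore] -/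
theorem isGammaIsoTw₂_elim0 {K₁ : Submodule ℚ K} {K₂ : Submodule ℚ K'} (σ : fieldOf K₁ ≃+* fieldOf K₂) :
    IsGammaIsoTw₂ σ (Fin.elim0 : Fin 0 → K) (Fin.elim0 : Fin 0 → K') := by
  intro M P
  have hP : P = MvPolynomial.C (P.coeff 0) := MvPolynomial.eq_C_of_isEmpty P
  rw [hP, MvPolynomial.map_C, MvPolynomial.aeval_C, MvPolynomial.aeval_C,
    map_eq_zero_iff _ (algebraMap (fieldOf K₁) K).injective,
    map_eq_zero_iff _ (algebraMap (fieldOf K₂) K').injective]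
  exact (map_eq_zero_iff (σ : fieldOf K₁ →+* fieldOf K₂) (σ : fieldOf K₁ →+* fieldOf K₂).injective).symm

/-! ### Kernel generators -/

omit [CharZero K] in
/-- A generator of the kernel has `exp τ = 1`. [folklore] -/
theorem exp_eq_one_of_expKernel {τ : K} (hker : expKernel K = AddSubgroup.zmultiples τ) : exp τ = 1 := by
  rw [← mem_expKernel_iff, hker]
  exact AddSubgroup.mem_zmultiples τ

/-- **Kernel elements lie in every `ecl`-closure**: if `exp τ = 1` then `τ ∈ ecl C` (as
`span ℚ (ecl C)` is Γ-closed, `GammaField.isGammaClosed_span_ecl_univ`, and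
`δ(τ/span (ecl C)) ≤ 0`, `predim_sup_span_kernelElement_le`). [cite: Kirby2010, Thm. 1.2]
[cite: BaysKirby2018ANT, Remark 10.10] -/
theorem mem_span_ecl_of_exp_eq_one {τ : K} (hexp : exp τ = 1) (C : Set K) :
    τ ∈ Submodule.span ℚ (ecl C) := by
  have hH := isGammaClosed_span_ecl_univ C
  have hfg : IsFG (Submodule.span ℚ (ecl C)) (Submodule.span ℚ (ecl C) ⊔ Submodule.span ℚ {τ}) :=
    isFG_sup_left.2 (isFG_span_of_finite _ (finite_singleton τ))
  have heq := hH le_sup_left hfg (predim_sup_span_kernelElement_le hexp _)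
  have hτ : τ ∈ Submodule.span ℚ (ecl C) ⊔ Submodule.span ℚ {τ} :=
    Submodule.mem_sup_right (Submodule.mem_span_singleton_self τ)
  rwa [heq] at hτ

/-! ### The covering relation of the back-and-forth -/

/-- **The back-and-forth relation across two fields**: the finite tuples `x` from `K`, `y` from
`K'` are *covered* by a cross Γ-isomorphism `c ↦ c'` over `σ` between tuples from `H₁`, `H₂`
spanning, together with the bases, strong subspaces. (Two-field form of
`ZilberHomogeneity.Covered`, without distinguished pair.) [cite: Kirby2010QMEC, Thm 2.1 (proof)] -/
def Covered₂ {K₁ : Submodule ℚ K} {K₂ : Submodule ℚ K'} (σ : fieldOf K₁ ≃+* fieldOf K₂)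
    (H₁ : Submodule ℚ K) (H₂ : Submodule ℚ K') (n : ℕ) (x : Fin n → K) (y : Fin n → K') : Prop :=
  ∃ (m : ℕ) (c : Fin m → K) (c' : Fin m → K'), IsGammaIsoTw₂ σ c c' ∧
    IsStrong (K₁ ⊔ Submodule.span ℚ (range c)) ∧ IsStrong (K₂ ⊔ Submodule.span ℚ (range c')) ∧
    (∀ i, c i ∈ H₁) ∧ (∀ i, c' i ∈ H₂) ∧ ∀ j, ∃ i, c i = x j ∧ c' i = y j

/-- Unfolding lemma for `Covered₂`. [folklore] -/
theorem covered₂_iff {K₁ : Submodule ℚ K} {K₂ : Submodule ℚ K'} {σ : fieldOf K₁ ≃+* fieldOf K₂}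
    {H₁ : Submodule ℚ K} {H₂ : Submodule ℚ K'} {n : ℕ} {x : Fin n → K} {y : Fin n → K'} :
    Covered₂ σ H₁ H₂ n x y ↔
      ∃ (m : ℕ) (c : Fin m → K) (c' : Fin m → K'), IsGammaIsoTw₂ σ c c' ∧
        IsStrong (K₁ ⊔ Submodule.span ℚ (range c)) ∧ IsStrong (K₂ ⊔ Submodule.span ℚ (range c')) ∧
        (∀ i, c i ∈ H₁) ∧ (∀ i, c' i ∈ H₂) ∧ ∀ j, ∃ i, c i = x j ∧ c' i = y j := Iff.rfl

/-- Symmetry of the covering relation (invert the cross Γ-isomorphism). [folklore] -/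
theorem Covered₂.symm {K₁ : Submodule ℚ K} {K₂ : Submodule ℚ K'} {σ : fieldOf K₁ ≃+* fieldOf K₂}
    {H₁ : Submodule ℚ K} {H₂ : Submodule ℚ K'} {n : ℕ} {x : Fin n → K} {y : Fin n → K'}
    (h : Covered₂ σ H₁ H₂ n x y) : Covered₂ σ.symm H₂ H₁ n y x := by
  obtain ⟨m, c, c', hiso, hs, hs', hcH, hc'H, hcov⟩ := h
  exact ⟨m, c', c, hiso.symm, hs', hs, hc'H, hcH, fun j => let ⟨i, hi, hi'⟩ := hcov j; ⟨i, hi', hi⟩⟩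

/-- Related tuples have the same pattern of equal coordinates. [folklore] -/
theorem Covered₂.apply_eq_iff {K₁ : Submodule ℚ K} {K₂ : Submodule ℚ K'} {σ : fieldOf K₁ ≃+* fieldOf K₂}
    {H₁ : Submodule ℚ K} {H₂ : Submodule ℚ K'} {n : ℕ} {x : Fin n → K} {y : Fin n → K'}
    (h : Covered₂ σ H₁ H₂ n x y) (i j : Fin n) : x i = x j ↔ y i = y j := by
  obtain ⟨m, c, c', hiso, -, -, -, -, hcov⟩ := h
  obtain ⟨p, hp, hp'⟩ := hcov i
  obtain ⟨q, hq, hq'⟩ := hcov j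
  rw [← hp, ← hq, ← hp', ← hq']
  exact hiso.apply_eq_iff p q

/-! ### Forth: realising one more exponentially algebraic point, across two fields -/

set_option maxHeartbeats 400000 in
/-- **Forth step over `ℚτ`, across two fields** (Kirby 2010, proof of Thm 2.1, in the prime-model
case; Bays–Kirby 2018 Lemma 8.3 as the engine). Let `K` have kernel `τ₁ℤ`, `K'` be algebraically
closed with `exp` onto `K'ˣ` and strongly exponentially-algebraically closed, `σ₀` an isomorphism
of the base Γ-fields `ℚ^{ab}(τ₁) ≅ ℚ^{ab}(τ₂)`, `H₁ ⊇ ℚτ₁`, `H₂ ⊇ ℚτ₂` Γ-closed subspaces with `H₁`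
exponentially algebraic over `ℚτ₁`. Then a covered pair extends by any point `d ∈ H₁` on the left
with a partner in `H₂`: `d` lies in a finitely generated strong `E ⊇ ℚτ₁ + ℚc` of predimension
`0` (`GammaField.exists_predim_le_zero_of_mem_ecl_coe` and minimisation of `δ`), which the cross
`ℵ₀`-saturation `ZilberSaturationLog.isGammaIsoTw₂_saturation_tau'` realises in `K'` with strong
image of predimension `0`, hence inside `H₂`
(`ZilberHomogeneity.le_of_predim_le_zero_of_isGammaClosed`).
[cite: Kirby2010QMEC, Thm 2.1 (proof)] [cite: BaysKirby2018ANT, Lemma 8.3, Def. 5.14] -/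
theorem Covered₂.forth_tau [IsAlgClosed K'] (hsurj : IsSurjectiveOntoUnits K')
    (hSEAC : IsStronglyExpAlgClosed K')
    {τ₁ : K} (hker : expKernel K = AddSubgroup.zmultiples τ₁) (hτ : τ₁ ≠ 0) {τ₂ : K'}
    {σ₀ : fieldOf (Submodule.span ℚ ({τ₁} : Set K)) ≃+* fieldOf (Submodule.span ℚ ({τ₂} : Set K'))}
    (hσ₀ : IsEBaseIso₂ (Submodule.span ℚ ({τ₁} : Set K)) (Submodule.span ℚ ({τ₂} : Set K')) σ₀)
    {H₁ : Submodule ℚ K} {H₂ : Submodule ℚ K'} (hH₁ : IsGammaClosed H₁) (hH₂ : IsGammaClosed H₂)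
    (hKH₁ : Submodule.span ℚ {τ₁} ≤ H₁) (hKH₂ : Submodule.span ℚ {τ₂} ≤ H₂)
    (hHecl : (H₁ : Set K) ⊆ ecl ((Submodule.span ℚ ({τ₁} : Set K) : Submodule ℚ K) : Set K))
    {n : ℕ} {x : Fin n → K} {y : Fin n → K'} (h : Covered₂ σ₀ H₁ H₂ n x y) {d : K} (hd : d ∈ H₁) :
    ∃ d' ∈ H₂, Covered₂ σ₀ H₁ H₂ (n + 1) (Fin.snoc x d) (Fin.snoc y d') := by
  classical
  obtain ⟨m, c, c', hiso, hs, hs', hcH, hc'H, hcov⟩ := h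
  set D : Submodule ℚ K := Submodule.span ℚ {τ₁} ⊔ Submodule.span ℚ (range c) with hDdef
  have hDH : D ≤ H₁ := sup_le hKH₁ (Submodule.span_le.2 (by rintro _ ⟨i, rfl⟩; exact hcH i))
  have hD'H : Submodule.span ℚ {τ₂} ⊔ Submodule.span ℚ (range c') ≤ H₂ :=
    sup_le hKH₂ (Submodule.span_le.2 (by rintro _ ⟨i, rfl⟩; exact hc'H i))
  -- `d` is exponentially algebraic over `D`
  have hdecl : d ∈ ecl ((D : Submodule ℚ K) : Set K) :=
    ecl_mono (fun z hz => (le_sup_left : Submodule.span ℚ {τ₁} ≤ D) hz) (hHecl hd)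
  obtain ⟨n₀, x₀, ⟨i₀, hi₀⟩, hδ₀⟩ := exists_predim_le_zero_of_mem_ecl_coe D hdecl
  -- minimise `δ` over finitely generated extensions of `D + ℚd`
  have hfgd : IsFG D (D ⊔ Submodule.span ℚ {d}) := isFG_sup_left.2 (isFG_span_of_finite D (finite_singleton d))
  obtain ⟨E, hdE, hfgE, -, hmin⟩ := hs.exists_forall_predim_le (fun _ => True) le_sup_left hfgd trivial
  have hDE : D ≤ E := le_sup_left.trans hdE
  have hdmem : d ∈ E := hdE (Submodule.mem_sup_right (Submodule.mem_span_singleton_self d))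
  have hEstrong : IsStrong E :=
    isStrong_of_forall_predim_le hDE hfgE fun X hX hfgX => hmin X (hdE.trans hX) hfgX trivial
  have hδE : predim D E = 0 := by
    refine le_antisymm ?_ (isStrong_iff.1 hs E hfgE)
    have h1 := hmin (D ⊔ Submodule.span ℚ (range x₀))
      (sup_le le_sup_left ((Submodule.span_singleton_le_iff_mem _ _).2
        (Submodule.mem_sup_right (Submodule.subset_span ⟨i₀, hi₀⟩))))
      (isFG_sup_left.2 (isFG_span_of_finite D (finite_range x₀))) trivial
    rw [predim_sup_left] at h1
    exact h1.trans hδ₀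
  -- generators `e = (d, s)` of `E` over `D`
  obtain ⟨s, hsE, hEle⟩ := isFG_iff_exists_finset.1 hfgE
  set e : Fin (s.card + 1) → K := Fin.cons d fun i => (s.equivFin.symm i : K) with he
  have he0 : e 0 = d := rfl
  have heE : ∀ i, e i ∈ E := by
    intro i
    refine Fin.cases ?_ (fun j => ?_) i
    · exact hdmem
    · simp only [he, Fin.cons_succ]
      exact hsE (s.equivFin.symm j).2
  have hDe : D ⊔ Submodule.span ℚ (range e) = E := by
    refine le_antisymm (sup_le hDE (Submodule.span_le.2 (by rintro _ ⟨i, rfl⟩; exact heE i))) ?_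
    refine hEle.trans (sup_le le_sup_left ((Submodule.span_mono ?_).trans le_sup_right))
    intro z hz
    refine ⟨Fin.succ (s.equivFin ⟨z, hz⟩), ?_⟩
    simp [he]
  have hδe : predim D (Submodule.span ℚ (range e)) = 0 := by
    rw [← predim_sup_left, hDe]; exact hδE
  -- cross saturation over `ℚτ`
  obtain ⟨e', hγ, hstr', hδ'⟩ := isGammaIsoTw₂_saturation_tau' hsurj hSEAC hker hτ hσ₀ hs hs' hiso hδe
  have hrange : Submodule.span ℚ {τ₁} ⊔ Submodule.span ℚ (range (Fin.append c e)) = E := by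
    rw [ZilberHomogeneity.range_append, Submodule.span_union, ← sup_assoc, ← hDdef, hDe]
  have heH : ∀ i, e i ∈ H₁ := fun i =>
    (le_of_predim_le_zero_of_isGammaClosed hs hH₁ hDH hDE hfgE hδE.le) (heE i)
  have he'H : ∀ i, e' i ∈ H₂ := by
    intro i
    have hfg' : IsFG (Submodule.span ℚ {τ₂} ⊔ Submodule.span ℚ (range c'))
        ((Submodule.span ℚ {τ₂} ⊔ Submodule.span ℚ (range c')) ⊔ Submodule.span ℚ (range e')) :=
      isFG_sup_left.2 (isFG_span_of_finite _ (finite_range e'))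
    have hE'H : (Submodule.span ℚ {τ₂} ⊔ Submodule.span ℚ (range c')) ⊔ Submodule.span ℚ (range e') ≤ H₂ :=
      le_of_predim_le_zero_of_isGammaClosed hs' hH₂ hD'H le_sup_left hfg'
        (by rw [predim_sup_left]; exact hδ'.le)
    exact hE'H (Submodule.mem_sup_right (Submodule.subset_span ⟨i, rfl⟩))
  refine ⟨e' 0, he'H 0, m + (s.card + 1), Fin.append c e, Fin.append c' e', hγ,
    by rw [hrange]; exact hEstrong, hstr', ?_, ?_, ?_⟩
  · intro i
    refine Fin.addCases (fun j => ?_) (fun j => ?_) i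
    · simpa only [Fin.append_left] using hcH j
    · simpa only [Fin.append_right] using heH j
  · intro i
    refine Fin.addCases (fun j => ?_) (fun j => ?_) i
    · simpa only [Fin.append_left] using hc'H j
    · simpa only [Fin.append_right] using he'H j
  · intro j
    refine Fin.lastCases ?_ (fun j' => ?_) j
    · exact ⟨Fin.natAdd m 0, by simp [he0], by simp⟩
    · obtain ⟨i, hi, hi'⟩ := hcov j'
      exact ⟨Fin.castAdd (s.card + 1) i, by simp [hi], by simp [hi']⟩

/-! ### The theorem -/

set_option maxHeartbeats 800000 in
/-- **The `ecl(∅)`'s of two Zilber fields are isomorphic exponential fields** (uniqueness of the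
prime model / the model of dimension `0`: Kirby 2013 (FPEF), Cor. 6.10; Zilber 2005, Lemma 5.11;
Bays–Kirby 2018, Thm 6.9 with Thm 9.1): for Zilber fields `K`, `K'` there is an E-ring embedding
`ecl^K(∅) → K'` with image `ecl^{K'}(∅)` — hypothesis `h₂` of
`ZilberClass.isQuasiminimalPregeometryClass_of`. Proof: two-structure back-and-forth between the
countable closures through cross Γ-isomorphisms over `σ₀ : ℚ^{ab}(τ₁) ≅ ℚ^{ab}(τ₂)`
(`Covered₂`, `Covered₂.forth_tau` on both sides); the limit preserves `0, 1, +, ·, exp`.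
[cite: Kirby2013FPEF, Cor. 6.10] [cite: Zilber2005PseudoExp, Lemma 5.11]
[cite: BaysKirby2018ANT, Thm 6.9, Lemma 8.3, Thm 9.1] [cite: Haykazyan2016, Definition 2] -/
theorem exists_eHom_eclEmpty (hK : IsZilberField K) (hK' : IsZilberField K') :
    ∃ φ : ExponentialRingHom (Khovanskii.eclSubfield (∅ : Set K)) K', Set.range φ = ecl ∅ := by
  classical
  haveI := hK.isAlgClosed
  haveI := hK'.isAlgClosed
  -- kernel generators and the base isomorphism
  obtain ⟨τ₁, hτ₁, hker₁⟩ := hK.hasStandardKernel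
  obtain ⟨τ₂, hτ₂, hker₂⟩ := hK'.hasStandardKernel
  have hexp₁ : exp τ₁ = 1 := exp_eq_one_of_expKernel hker₁
  have hexp₂ : exp τ₂ = 1 := exp_eq_one_of_expKernel hker₂
  have hτ₁0 : τ₁ ≠ 0 := fun h => hτ₁ (by rw [h]; exact isAlgebraic_zero)
  have hτ₂0 : τ₂ ≠ 0 := fun h => hτ₂ (by rw [h]; exact isAlgebraic_zero)
  obtain ⟨σ₀, hσ₀, -⟩ := exists_isEBaseIso₂_of_expKernel hker₁ hτ₁ hker₂ hτ₂
  have hs₁ : IsStrong (Submodule.span ℚ ({τ₁} : Set K)) :=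
    (schanuelProperty_iff_isStrong_span_kernelGenerator hτ₁ hexp₁).1 hK.schanuelProperty
  have hs₂ : IsStrong (Submodule.span ℚ ({τ₂} : Set K')) :=
    (schanuelProperty_iff_isStrong_span_kernelGenerator hτ₂ hexp₂).1 hK'.schanuelProperty
  -- the closures
  set H₁ : Submodule ℚ K := Submodule.span ℚ (ecl (∅ : Set K)) with hH₁def
  set H₂ : Submodule ℚ K' := Submodule.span ℚ (ecl (∅ : Set K')) with hH₂def
  have hH₁ : IsGammaClosed H₁ := isGammaClosed_span_ecl_univ _
  have hH₂ : IsGammaClosed H₂ := isGammaClosed_span_ecl_univ _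
  have hmemH₁ : ∀ {z : K}, z ∈ H₁ ↔ z ∈ ecl (∅ : Set K) := fun {z} => by
    rw [← SetLike.mem_coe, hH₁def, coe_span_ecl]
  have hmemH₂ : ∀ {z : K'}, z ∈ H₂ ↔ z ∈ ecl (∅ : Set K') := fun {z} => by
    rw [← SetLike.mem_coe, hH₂def, coe_span_ecl]
  have hKH₁ : Submodule.span ℚ {τ₁} ≤ H₁ :=
    (Submodule.span_singleton_le_iff_mem _ _).2 (mem_span_ecl_of_exp_eq_one hexp₁ ∅)
  have hKH₂ : Submodule.span ℚ {τ₂} ≤ H₂ :=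
    (Submodule.span_singleton_le_iff_mem _ _).2 (mem_span_ecl_of_exp_eq_one hexp₂ ∅)
  have hHecl₁ : (H₁ : Set K) ⊆ ecl ((Submodule.span ℚ ({τ₁} : Set K) : Submodule ℚ K) : Set K) :=
    fun z hz => ecl_mono (empty_subset _) (hmemH₁.1 hz)
  have hHecl₂ : (H₂ : Set K') ⊆ ecl ((Submodule.span ℚ ({τ₂} : Set K') : Submodule ℚ K') : Set K') :=
    fun z hz => ecl_mono (empty_subset _) (hmemH₂.1 hz)
  -- the starting pair: the empty tuples
  have hstart : Covered₂ σ₀ H₁ H₂ 0 Fin.elim0 Fin.elim0 := by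
    have he0 : range (Fin.elim0 : Fin 0 → K) = ∅ := Set.range_eq_empty _
    have he0' : range (Fin.elim0 : Fin 0 → K') = ∅ := Set.range_eq_empty _
    refine ⟨0, Fin.elim0, Fin.elim0, isGammaIsoTw₂_elim0 σ₀, ?_, ?_, fun i => i.elim0, fun i => i.elim0,
      fun j => j.elim0⟩
    · rw [he0, Submodule.span_empty, sup_bot_eq]; exact hs₁
    · rw [he0', Submodule.span_empty, sup_bot_eq]; exact hs₂
  -- countability
  have hC₁ : ((H₁ : Set K)).Countable := countable_span_ecl hK.hasCountableClosureProperty countable_empty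
  have hC₂ : ((H₂ : Set K')).Countable := countable_span_ecl hK'.hasCountableClosureProperty countable_empty
  -- the back-and-forth
  obtain ⟨g', himg, hcov⟩ := exists_map_of_backAndForth₂ (M := K) (N := K')
    (S := fun n x y => Covered₂ σ₀ H₁ H₂ n x y) (C := (H₁ : Set K)) (C' := (H₂ : Set K')) hC₁ hC₂
    hstart (fun n x y h i j => h.apply_eq_iff i j)
    (fun n x y h _ _ d hd => Covered₂.forth_tau hK'.isSurjectiveOntoUnits hK'.isStronglyExpAlgClosed
      hker₁ hτ₁0 hσ₀ hH₁ hH₂ hKH₁ hKH₂ hHecl₁ h hd)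
    (fun n x y h _ _ d hd => by
      obtain ⟨d₀, hd₀, hcov⟩ := Covered₂.forth_tau hK.isSurjectiveOntoUnits hK.isStronglyExpAlgClosed
        hker₂ hτ₂0 hσ₀.symm hH₂ hH₁ hKH₂ hKH₁ hHecl₂ h.symm hd
      refine ⟨d₀, hd₀, ?_⟩
      have := hcov.symm
      rwa [RingEquiv.symm_symm] at this)
  -- extracting a covering pair for finitely many points of `H₁`
  have hpair : ∀ {k : ℕ} (t : Fin k → K), (∀ i, t i ∈ H₁) →
      ∃ (m : ℕ) (c : Fin m → K) (c' : Fin m → K'), IsGammaIsoTw₂ σ₀ c c' ∧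
        ∀ j, ∃ i, c i = t j ∧ c' i = g' (t j) := by
    intro k t ht
    obtain ⟨n₀, x, y, hS, -, -, ι, hx, hy⟩ := hcov t ht
    obtain ⟨m', c, c', hiso, -, -, -, -, hcv⟩ := hS
    refine ⟨m', c, c', hiso, fun j => ?_⟩
    obtain ⟨i, hi, hi'⟩ := hcv (ι j)
    exact ⟨i, by rw [hi]; exact congrFun hx j, by rw [hi']; exact congrFun hy j⟩
  -- the E-ring embedding
  have hmem : ∀ z : Khovanskii.eclSubfield (∅ : Set K), (z : K) ∈ H₁ := fun z => hmemH₁.2 z.2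
  have hone : g' 1 = 1 := by
    obtain ⟨m', c, c', hiso, hcv⟩ := hpair ![(1 : K)] (fun i => by
      fin_cases i; exact hmemH₁.2 (Khovanskii.one_mem_ecl _))
    obtain ⟨i, hi, hi'⟩ := hcv 0
    simp only [Matrix.cons_val_zero] at hi hi'
    rw [← hi']
    exact eq_one hiso hi
  have hzero : g' 0 = 0 := by
    obtain ⟨m', c, c', hiso, hcv⟩ := hpair ![(0 : K)] (fun i => by
      fin_cases i; exact hmemH₁.2 (Khovanskii.zero_mem_ecl _))
    obtain ⟨i, hi, hi'⟩ := hcv 0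
    simp only [Matrix.cons_val_zero] at hi hi'
    rw [← hi']
    exact eq_zero hiso hi
  have hadd : ∀ u v : Khovanskii.eclSubfield (∅ : Set K), g' (u + v) = g' u + g' v := by
    intro u v
    obtain ⟨m', c, c', hiso, hcv⟩ := hpair ![(u : K), (v : K), (u : K) + (v : K)]
      (fun i => by fin_cases i <;> [exact hmem u; exact hmem v; exact hmem (u + v)])
    obtain ⟨i, hi, hi'⟩ := hcv 0
    obtain ⟨j, hj, hj'⟩ := hcv 1
    obtain ⟨k, hk, hk'⟩ := hcv 2
    simp only [Matrix.cons_val_zero, Matrix.cons_val_one, Matrix.head_cons, Matrix.cons_val_two,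
      Matrix.tail_cons] at hi hi' hj hj' hk hk'
    have := add_eq hiso (i := i) (j := j) (k := k) (by rw [hi, hj, hk])
    rw [hi', hj', hk'] at this
    exact this.symm
  have hmul : ∀ u v : Khovanskii.eclSubfield (∅ : Set K), g' (u * v) = g' u * g' v := by
    intro u v
    obtain ⟨m', c, c', hiso, hcv⟩ := hpair ![(u : K), (v : K), (u : K) * (v : K)]
      (fun i => by fin_cases i <;> [exact hmem u; exact hmem v; exact hmem (u * v)])
    obtain ⟨i, hi, hi'⟩ := hcv 0
    obtain ⟨j, hj, hj'⟩ := hcv 1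
    obtain ⟨k, hk, hk'⟩ := hcv 2
    simp only [Matrix.cons_val_zero, Matrix.cons_val_one, Matrix.head_cons, Matrix.cons_val_two,
      Matrix.tail_cons] at hi hi' hj hj' hk hk'
    have := mul_eq hiso (i := i) (j := j) (k := k) (by rw [hi, hj, hk])
    rw [hi', hj', hk'] at this
    exact this.symm
  have hexpmap : ∀ u : Khovanskii.eclSubfield (∅ : Set K), g' (exp (u : K)) = exp (g' u) := by
    intro u
    obtain ⟨m', c, c', hiso, hcv⟩ := hpair ![(u : K), exp (u : K)]
      (fun i => by fin_cases i <;> [exact hmem u; exact hmem (exp u)])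
    obtain ⟨i, hi, hi'⟩ := hcv 0
    obtain ⟨k, hk, hk'⟩ := hcv 1
    simp only [Matrix.cons_val_zero, Matrix.cons_val_one] at hi hi' hk hk'
    have := exp_eq hiso (i := i) (k := k) (by rw [hi, hk])
    rw [hi', hk'] at this
    exact this.symm
  let φ : ExponentialRingHom (Khovanskii.eclSubfield (∅ : Set K)) K' :=
    { toFun := fun z => g' z
      map_one' := hone
      map_mul' := hmul
      map_zero' := hzero
      map_add' := hadd
      map_exp' := fun u => by exact hexpmap u }
  have hφ : ∀ z, φ z = g' z := fun _ => rfl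
  refine ⟨φ, ?_⟩
  have hHset₂ : ((H₂ : Set K')) = ecl (∅ : Set K') := by rw [hH₂def, coe_span_ecl]
  ext w
  constructor
  · rintro ⟨z, rfl⟩
    rw [hφ, ← hHset₂, ← himg]
    exact mem_image_of_mem g' (hmem z)
  · intro hw
    rw [← hHset₂, ← himg] at hw
    obtain ⟨z, hz, rfl⟩ := hw
    exact ⟨⟨z, hmemH₁.1 hz⟩, hφ _⟩

end ZilberPrimeModel

end Literature.NumberTheory.Transcendental
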